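import Summits.CriticalPhenomena.PercolationContinuityZ3.Theorems.PercNearOneGluingNoHeavyLowerTailSunflowerDaykinChain
import Literature.Probability.LatticeModels.ProdBernoulliReimer
import HarnessLib

/-!
# `NoHeavyLowerTail` (crux stmt-CriticalPhenomena-4575), abstract sunflower cubic at LAW level: the DISJOINT-OCCURRENCE
# (van den Berg–Kesten) stratum — Lemma A `μ(E₁) μ(E₂) μ(E₃) ≤ μ(A)²` (resp. Lemma B) from Harris + BK through the
# CORE SHADOWS `G_i = {S | ↑S ∩ E_i ⊆ A}`; hence (C1-law), H-COMB, the `G`-row on this stratum, every `p`; the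
# coproduct class `E_i = Y_j ∩ Y_k` (arbitrary up-set blocks, two of them on disjoint supports) lies in it

Support file (seat `prim-ineq-gen-2` gen 31; `--supports stmt-CriticalPhenomena-4575`).  Nothing is asserted about the crux; no
`sorry`, no named facts, standard axioms.  Memo: run/shared/lean/prim/prim-ineq-gen-2/BK-STRATUM-GEN31.md.

SETTING.  `μ = prodBernoulli p` on `Set ι`, `ι` finite; a three-petal sunflower of up-sets `E₁ ∩ E₂ = E₁ ∩ E₃ = E₂ ∩ E₃ = A`, cells
`a = μ A`, `c_i = μ (E_i ∖ A)`, `b = μ (E₁ ∪ E₂ ∪ E₃)ᶜ`, `AG = ab − e₂(c) ≥ 0` (Gladkov); Lemma A `LA = a·AG − e₃ = a² − Π μ(E_i) ≥ 0`,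
Lemma B `LB = b·AG − e₃ = b² − Π μ((E_j ∪ E_k)ᶜ) ≥ 0`, the dichotomy (C1-law) `e₃ ≤ max(a,b)·AG` (CONJECTURE in general) and
H-COMB `(a+b)AG ≥ e₃` (CONJECTURE in general) — as in `…SunflowerDaykinChain` (gen 29), `…SunflowerPrincipalCore` (prove-1 g34).

THIS FILE — a new tool for the lane (disjoint occurrence; all previous strata used Harris / Ahlswede–Daykin / certificates only):

* `coreShadow E A = {S | ∀ T ⊇ S, T ∈ E → T ∈ A}` — the largest up-set `G` with `G ∩ E ⊆ A` (`coreShadow_inter_subset`,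
  `subset_coreShadow_of_inter_subset`); for a sunflower `G_i := coreShadow E_i A = (↓(E_i ∖ A))ᶜ ⊇ E_j ∪ E_k`, and
  `S ∈ G_i ↔ ∀ S'' ∈ E_i, S ∪ S'' ∈ A` (`mem_coreShadow_iff_union_mem`), so gen 29's meet–join condition
  `(S ∩ S') ∪ S'' ∈ A` reads `E_i ⊼ E_j ⊆ G_k`.
* `lemmaA_of_bk` — **LEMMA A ON THE BK STRATUM**: for up-sets `E₁, E₂` and ANY events `E₃, A` with
  `E₃ ⊆ coreShadow E₁ A □ coreShadow E₂ A` (every member of `E₃` splits into two disjoint sets, one contained in no member of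
  `E₁ ∖ A`, the other in no member of `E₂ ∖ A`):  `μ(E₁) μ(E₂) μ(E₃) ≤ μ(A)²`, every `p`.
  PROOF (three lines): Harris `μ(G_i) μ(E_i) ≤ μ(G_i ∩ E_i) ≤ μ(A)` (`i = 1,2`) and van den Berg–Kesten
  `μ(E₃) ≤ μ(G₁ □ G₂) ≤ μ(G₁) μ(G₂)` (`Literature…prodBernoulli_bk_local`).  In conditional form: `P(A | E₁) P(A | E₂) ≥ μ(G₁) μ(G₂) ≥ μ(E₃)`.
  All three steps are EQUALITIES on the coproduct class (`E_i = Y_j ∩ Y_k`, blocks on disjoint supports), the sheet `LA ≡ 0`.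
* `lemmaB_of_bk` — the dual: down-sets `D₁, D₂`, `bottomShadow D B = {S | ∀ T ⊆ S, T ∈ D → T ∈ B}`,
  `D₃ ⊆ bottomShadow D₁ B □ bottomShadow D₂ B ⟹ μ(D₁) μ(D₂) μ(D₃) ≤ μ(B)²` (Harris for down-sets + Reimer's form of BK,
  `Literature…prodBernoulli_reimer_local`, since the tree's BK is stated for up-sets).
* CELL ROWS for a sunflower of up-sets on the stratum (pattern of `…DaykinChain`): `e3_le_core_mul_AG_of_bk` (Lemma A in cells),
  `e3_le_max_mul_AG_of_bk` ((C1-law)), `lawH_nonneg_of_bk` (H-COMB), `AG_ge_e3_of_bk` (`G`-row); duals `e3_le_bottom_mul_AG_of_bkB`,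
  `e3_le_max_mul_AG_of_bkB`, `lawH_nonneg_of_bkB`.
* `coproduct_subset_disjointOccurrence` / `lemmaA_of_coproduct` — the COPRODUCT CLASS `E₁ = Y₂ ∩ Y₃`, `E₂ = Y₁ ∩ Y₃`, `E₃ = Y₁ ∩ Y₂`
  (`Y_i` ANY up-sets, `Y₁`, `Y₂` determined by disjoint coordinate sets, `Y₃` unrestricted) lies in the BK stratum, so Lemma A
  holds there for every `p` (for principal `Y_i` this is the `n = 3` PC* example; the Daykin-chain stratum does NOT contain the
  coproduct class with non-principal blocks, since `S ∩ S'` of two `Y₃`-sets need not lie in `Y₃`).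

CENSUS (memo §2; not used in the proofs): among the 2 022 three-petal sunflowers with three non-empty petals on 4 labelled points the
BK strata (A- or B-side, some labelling) contain 1 427, the meet–join/join–meet strata of gen 29 contain 900, and every meet–join
structure is a BK structure (also in 11 215 + 19 583 sampled meet–join structures on 5 and 6 points: no exception); 318 of the 595
uncovered structures are "switchers" (`LA < 0` at some `p` and `LB < 0` at another), which no `p`-independent stratum can cover.
-/

noncomputable section

namespace Summit.CriticalPhenomena.PercolationContinuityZ3.Theorems.SunflowerPartition

namespace BKStratum

open MeasureTheory
open Literature.Probability.LatticeModels Literature.Probability.Percolation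

variable {ι : Type*}

/-! ## Core shadows and bottom shadows -/

/-- The **core shadow** of `E` relative to `A`: the sets all of whose supersets lying in `E` already lie in `A`; for a sunflower
petal `E_i ⊇ A` it is the complement of the down-closure of the petal cell `E_i ∖ A`. [this work] -/
def coreShadow (E A : Set (Set ι)) : Set (Set ι) := {S | ∀ ⦃T : Set ι⦄, S ⊆ T → T ∈ E → T ∈ A}

/-- The **bottom shadow** of `D` relative to `B`: the sets all of whose subsets lying in `D` already lie in `B` (order dual of
`coreShadow`). [this work] -/
def bottomShadow (D B : Set (Set ι)) : Set (Set ι) := {S | ∀ ⦃T : Set ι⦄, T ⊆ S → T ∈ D → T ∈ B}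

/-- The core shadow is an up-set. [this work] -/
theorem isUpperSet_coreShadow (E A : Set (Set ι)) : IsUpperSet (coreShadow E A) :=
  fun _ _ hSS' hS _ hS'T hT => hS (hSS'.trans hS'T) hT

/-- The bottom shadow is a down-set. [this work] -/
theorem isLowerSet_bottomShadow (D B : Set (Set ι)) : IsLowerSet (bottomShadow D B) :=
  fun _ _ hS'S hS _ hTS' hT => hS (hTS'.trans hS'S) hT

/-- `coreShadow E A ∩ E ⊆ A`. [this work] -/
theorem coreShadow_inter_subset (E A : Set (Set ι)) : coreShadow E A ∩ E ⊆ A :=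
  fun _ ⟨hG, hE⟩ => hG subset_rfl hE

/-- `bottomShadow D B ∩ D ⊆ B`. [this work] -/
theorem bottomShadow_inter_subset (D B : Set (Set ι)) : bottomShadow D B ∩ D ⊆ B :=
  fun _ ⟨hH, hD⟩ => hH subset_rfl hD

/-- Maximality: every up-set meeting `E` inside `A` lies in the core shadow. [this work] -/
theorem subset_coreShadow_of_inter_subset {G E A : Set (Set ι)} (hG : IsUpperSet G) (h : G ∩ E ⊆ A) :
    G ⊆ coreShadow E A :=
  fun _ hS _ hST hT => h ⟨hG hST hS, hT⟩

/-- Maximality: every down-set meeting `D` inside `B` lies in the bottom shadow. [this work] -/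
theorem subset_bottomShadow_of_inter_subset {H D B : Set (Set ι)} (hH : IsLowerSet H) (h : H ∩ D ⊆ B) :
    H ⊆ bottomShadow D B :=
  fun _ hS _ hTS hT => h ⟨hH hTS hS, hT⟩

/-- An up-set `A` lies in every core shadow relative to `A`. [this work] -/
theorem subset_coreShadow_self {E A : Set (Set ι)} (hA : IsUpperSet A) : A ⊆ coreShadow E A :=
  fun _ hS _ hST _ => hA hST hS

/-- For a sunflower, the other petals lie in the core shadow: `E_j ∩ E_i ⊆ A ⟹ E_j ⊆ coreShadow E_i A`. [this work] -/
theorem subset_coreShadow_of_upperSet {E E' A : Set (Set ι)} (hE' : IsUpperSet E') (h : E' ∩ E ⊆ A) :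
    E' ⊆ coreShadow E A :=
  subset_coreShadow_of_inter_subset hE' h

/-- For an up-set `E`, membership in the core shadow is the "join" condition of the meet–join stratum:
`S ∈ coreShadow E A ↔ ∀ S'' ∈ E, S ∪ S'' ∈ A`.  (So gen 29's condition `(S ∩ S') ∪ S'' ∈ A` says `E_i ⊼ E_j ⊆ coreShadow E_k A`.)
[this work] -/
theorem mem_coreShadow_iff_union_mem {E A : Set (Set ι)} (hE : IsUpperSet E) (S : Set ι) :
    S ∈ coreShadow E A ↔ ∀ S'' ∈ E, S ∪ S'' ∈ A := by
  constructor
  · intro hS S'' hS''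
    exact hS Set.subset_union_left (hE Set.subset_union_right hS'')
  · intro h T hST hT
    have := h T hT
    rwa [Set.union_eq_right.2 hST] at this

/-! ## Lemma A / Lemma B on the disjoint-occurrence stratum -/

/-- On a finite index type every event is local (for `prodBernoulli_bk_local` / `prodBernoulli_reimer_local`). [folklore] -/
theorem isLocalEvent_of_fintype' [Fintype ι] (X : Set (Set ι)) : IsLocalEvent X := by
  classical
  refine ⟨Finset.univ, ?_⟩
  rw [determinedBy_iff]
  intro ω ω' h
  rw [Finset.coe_univ, Set.inter_univ, Set.inter_univ] at h
  rw [h]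

/-- **The Harris step**: `μ(coreShadow E A) · μ(E) ≤ μ(A)` for an up-set `E`. [this work] -/
theorem real_coreShadow_mul_real_le [Fintype ι] (p : ι → unitInterval) {E : Set (Set ι)} (hE : IsUpperSet E)
    (A : Set (Set ι)) :
    (prodBernoulli p).real (coreShadow E A) * (prodBernoulli p).real E ≤ (prodBernoulli p).real A := by
  classical
  calc (prodBernoulli p).real (coreShadow E A) * (prodBernoulli p).real E
      ≤ (prodBernoulli p).real (coreShadow E A ∩ E) :=
        prodBernoulli_harris p (isUpperSet_coreShadow E A) hE MeasurableSet.of_discrete MeasurableSet.of_discrete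
    _ ≤ (prodBernoulli p).real A := measureReal_mono (coreShadow_inter_subset E A)

/-- **The Harris step, dual**: `μ(bottomShadow D B) · μ(D) ≤ μ(B)` for a down-set `D`. [this work] -/
theorem real_bottomShadow_mul_real_le [Fintype ι] (p : ι → unitInterval) {D : Set (Set ι)} (hD : IsLowerSet D)
    (B : Set (Set ι)) :
    (prodBernoulli p).real (bottomShadow D B) * (prodBernoulli p).real D ≤ (prodBernoulli p).real B := by
  classical
  calc (prodBernoulli p).real (bottomShadow D B) * (prodBernoulli p).real D
      ≤ (prodBernoulli p).real (bottomShadow D B ∩ D) :=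
        prodBernoulli_harris_lower p (isLowerSet_bottomShadow D B) hD MeasurableSet.of_discrete MeasurableSet.of_discrete
    _ ≤ (prodBernoulli p).real B := measureReal_mono (bottomShadow_inter_subset D B)

/-- **LEMMA A ON THE BK STRATUM.**  For up-sets `E₁, E₂` and any events `E₃, A`: if every member of `E₃` witnesses the two core
shadows `coreShadow E₁ A`, `coreShadow E₂ A` on DISJOINT sets of present coordinates, then `μ(E₁) μ(E₂) μ(E₃) ≤ μ(A)²` under every
product measure — Harris twice and van den Berg–Kesten once. [this work] -/
theorem lemmaA_of_bk [Fintype ι] (p : ι → unitInterval) {E₁ E₂ E₃ A : Set (Set ι)} (h₁ : IsUpperSet E₁)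
    (h₂ : IsUpperSet E₂) (hbk : E₃ ⊆ coreShadow E₁ A □ coreShadow E₂ A) :
    (prodBernoulli p).real E₁ * (prodBernoulli p).real E₂ * (prodBernoulli p).real E₃ ≤
      ((prodBernoulli p).real A) ^ 2 := by
  classical
  set μ := prodBernoulli p with hμ
  have hH₁ := real_coreShadow_mul_real_le p h₁ A
  have hH₂ := real_coreShadow_mul_real_le p h₂ A
  have hBK : μ.real E₃ ≤ μ.real (coreShadow E₁ A) * μ.real (coreShadow E₂ A) :=
    (measureReal_mono hbk).trans
      (prodBernoulli_bk_local p (isUpperSet_coreShadow E₁ A) (isUpperSet_coreShadow E₂ A)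
        (isLocalEvent_of_fintype' _) (isLocalEvent_of_fintype' _))
  have e₁ : 0 ≤ μ.real E₁ := measureReal_nonneg
  have e₂ : 0 ≤ μ.real E₂ := measureReal_nonneg
  have g₁ : 0 ≤ μ.real (coreShadow E₁ A) := measureReal_nonneg
  have g₂ : 0 ≤ μ.real (coreShadow E₂ A) := measureReal_nonneg
  calc μ.real E₁ * μ.real E₂ * μ.real E₃
      ≤ μ.real E₁ * μ.real E₂ * (μ.real (coreShadow E₁ A) * μ.real (coreShadow E₂ A)) :=
        mul_le_mul_of_nonneg_left hBK (mul_nonneg e₁ e₂)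
    _ = (μ.real (coreShadow E₁ A) * μ.real E₁) * (μ.real (coreShadow E₂ A) * μ.real E₂) := by ring
    _ ≤ μ.real A * μ.real A :=
        mul_le_mul hH₁ hH₂ (mul_nonneg g₂ e₂) measureReal_nonneg
    _ = (μ.real A) ^ 2 := by ring

/-- **LEMMA B ON THE BK STRATUM** (order dual).  For down-sets `D₁, D₂` and any events `D₃, B`: if
`D₃ ⊆ bottomShadow D₁ B □ bottomShadow D₂ B`, then `μ(D₁) μ(D₂) μ(D₃) ≤ μ(B)²` under every product measure — Harris for
down-sets twice and Reimer's (= BK for arbitrary events) inequality once. [this work] -/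
theorem lemmaB_of_bk [Fintype ι] (p : ι → unitInterval) {D₁ D₂ D₃ B : Set (Set ι)} (h₁ : IsLowerSet D₁)
    (h₂ : IsLowerSet D₂) (hbk : D₃ ⊆ bottomShadow D₁ B □ bottomShadow D₂ B) :
    (prodBernoulli p).real D₁ * (prodBernoulli p).real D₂ * (prodBernoulli p).real D₃ ≤
      ((prodBernoulli p).real B) ^ 2 := by
  classical
  set μ := prodBernoulli p with hμ
  have hH₁ := real_bottomShadow_mul_real_le p h₁ B
  have hH₂ := real_bottomShadow_mul_real_le p h₂ B
  have hBK : μ.real D₃ ≤ μ.real (bottomShadow D₁ B) * μ.real (bottomShadow D₂ B) :=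
    (measureReal_mono hbk).trans
      (prodBernoulli_reimer_local p (isLocalEvent_of_fintype' _) (isLocalEvent_of_fintype' _))
  have e₁ : 0 ≤ μ.real D₁ := measureReal_nonneg
  have e₂ : 0 ≤ μ.real D₂ := measureReal_nonneg
  have g₂ : 0 ≤ μ.real (bottomShadow D₂ B) := measureReal_nonneg
  calc μ.real D₁ * μ.real D₂ * μ.real D₃
      ≤ μ.real D₁ * μ.real D₂ * (μ.real (bottomShadow D₁ B) * μ.real (bottomShadow D₂ B)) :=
        mul_le_mul_of_nonneg_left hBK (mul_nonneg e₁ e₂)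
    _ = (μ.real (bottomShadow D₁ B) * μ.real D₁) * (μ.real (bottomShadow D₂ B) * μ.real D₂) := by ring
    _ ≤ μ.real B * μ.real B :=
        mul_le_mul hH₁ hH₂ (mul_nonneg g₂ e₂) measureReal_nonneg
    _ = (μ.real B) ^ 2 := by ring

/-! ## The law-level rows in cells, for a sunflower of up-sets on the stratum -/

section Cells

variable [Fintype ι]

/-- **Lemma A in cells** on the BK stratum: `c₁c₂c₃ ≤ a·(ab − (c₁c₂ + c₁c₃ + c₂c₃))`, every `p`. [this work] -/
theorem e3_le_core_mul_AG_of_bk (p : ι → unitInterval) {E₁ E₂ E₃ A : Set (Set ι)} (h₁ : IsUpperSet E₁)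
    (h₂ : IsUpperSet E₂) (h12 : E₁ ∩ E₂ = A) (h13 : E₁ ∩ E₃ = A) (h23 : E₂ ∩ E₃ = A)
    (hbk : E₃ ⊆ coreShadow E₁ A □ coreShadow E₂ A) :
    (prodBernoulli p).real (E₁ \ A) * (prodBernoulli p).real (E₂ \ A) * (prodBernoulli p).real (E₃ \ A) ≤
      (prodBernoulli p).real A * ((prodBernoulli p).real A * (prodBernoulli p).real (E₁ ∪ E₂ ∪ E₃)ᶜ -
        ((prodBernoulli p).real (E₁ \ A) * (prodBernoulli p).real (E₂ \ A) +
          (prodBernoulli p).real (E₁ \ A) * (prodBernoulli p).real (E₃ \ A) +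
          (prodBernoulli p).real (E₂ \ A) * (prodBernoulli p).real (E₃ \ A))) := by
  have key := lemmaA_of_bk p h₁ h₂ hbk
  obtain ⟨e₁, e₂, e₃, eB⟩ := PrincipalCore.cells_eq p h12 h13 h23
  rw [e₁, e₂, e₃] at key
  rw [eB]
  nlinarith [key]

/-- **(C1-law) on the BK stratum**: `e₃ ≤ max(a,b)·(ab − e₂)`, every `p`. [this work] -/
theorem e3_le_max_mul_AG_of_bk (p : ι → unitInterval) {E₁ E₂ E₃ A : Set (Set ι)} (h₁ : IsUpperSet E₁)
    (h₂ : IsUpperSet E₂) (h₃ : IsUpperSet E₃) (h12 : E₁ ∩ E₂ = A) (h13 : E₁ ∩ E₃ = A) (h23 : E₂ ∩ E₃ = A)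
    (hbk : E₃ ⊆ coreShadow E₁ A □ coreShadow E₂ A) :
    (prodBernoulli p).real (E₁ \ A) * (prodBernoulli p).real (E₂ \ A) * (prodBernoulli p).real (E₃ \ A) ≤
      max ((prodBernoulli p).real A) ((prodBernoulli p).real (E₁ ∪ E₂ ∪ E₃)ᶜ) *
        ((prodBernoulli p).real A * (prodBernoulli p).real (E₁ ∪ E₂ ∪ E₃)ᶜ -
          ((prodBernoulli p).real (E₁ \ A) * (prodBernoulli p).real (E₂ \ A) +
            (prodBernoulli p).real (E₁ \ A) * (prodBernoulli p).real (E₃ \ A) +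
            (prodBernoulli p).real (E₂ \ A) * (prodBernoulli p).real (E₃ \ A))) := by
  have hLA := e3_le_core_mul_AG_of_bk p h₁ h₂ h12 h13 h23 hbk
  have hAG := prodBernoulli_strongHarris_sunflower_three p h₁ h₂ h₃ h12 h13 h23
  have hmax : (prodBernoulli p).real A ≤ max ((prodBernoulli p).real A) ((prodBernoulli p).real (E₁ ∪ E₂ ∪ E₃)ᶜ) :=
    le_max_left _ _
  nlinarith [hmax, hAG, hLA]

/-- **H-COMB on the BK stratum**: `(a + b)(ab − e₂) ≥ e₃`, every `p` (`H = LA + b·AG`). [this work] -/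
theorem lawH_nonneg_of_bk (p : ι → unitInterval) {E₁ E₂ E₃ A : Set (Set ι)} (h₁ : IsUpperSet E₁)
    (h₂ : IsUpperSet E₂) (h₃ : IsUpperSet E₃) (h12 : E₁ ∩ E₂ = A) (h13 : E₁ ∩ E₃ = A) (h23 : E₂ ∩ E₃ = A)
    (hbk : E₃ ⊆ coreShadow E₁ A □ coreShadow E₂ A) :
    0 ≤ ((prodBernoulli p).real A + (prodBernoulli p).real (E₁ ∪ E₂ ∪ E₃)ᶜ) *
        ((prodBernoulli p).real A * (prodBernoulli p).real (E₁ ∪ E₂ ∪ E₃)ᶜ -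
          ((prodBernoulli p).real (E₁ \ A) * (prodBernoulli p).real (E₂ \ A) +
            (prodBernoulli p).real (E₁ \ A) * (prodBernoulli p).real (E₃ \ A) +
            (prodBernoulli p).real (E₂ \ A) * (prodBernoulli p).real (E₃ \ A))) -
      (prodBernoulli p).real (E₁ \ A) * (prodBernoulli p).real (E₂ \ A) * (prodBernoulli p).real (E₃ \ A) := by
  have hLA := e3_le_core_mul_AG_of_bk p h₁ h₂ h12 h13 h23 hbk
  have hAG := prodBernoulli_strongHarris_sunflower_three p h₁ h₂ h₃ h12 h13 h23
  have hb : 0 ≤ (prodBernoulli p).real (E₁ ∪ E₂ ∪ E₃)ᶜ := measureReal_nonneg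
  nlinarith [hb, hAG, hLA]

/-- **The `G`-row on the BK stratum**: `ab − e₂ ≥ e₃` (Lemma A and `a ≤ 1`). [this work] -/
theorem AG_ge_e3_of_bk (p : ι → unitInterval) {E₁ E₂ E₃ A : Set (Set ι)} (h₁ : IsUpperSet E₁)
    (h₂ : IsUpperSet E₂) (h₃ : IsUpperSet E₃) (h12 : E₁ ∩ E₂ = A) (h13 : E₁ ∩ E₃ = A) (h23 : E₂ ∩ E₃ = A)
    (hbk : E₃ ⊆ coreShadow E₁ A □ coreShadow E₂ A) :
    (prodBernoulli p).real (E₁ \ A) * (prodBernoulli p).real (E₂ \ A) * (prodBernoulli p).real (E₃ \ A) ≤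
      (prodBernoulli p).real A * (prodBernoulli p).real (E₁ ∪ E₂ ∪ E₃)ᶜ -
        ((prodBernoulli p).real (E₁ \ A) * (prodBernoulli p).real (E₂ \ A) +
          (prodBernoulli p).real (E₁ \ A) * (prodBernoulli p).real (E₃ \ A) +
          (prodBernoulli p).real (E₂ \ A) * (prodBernoulli p).real (E₃ \ A)) := by
  have hLA := e3_le_core_mul_AG_of_bk p h₁ h₂ h12 h13 h23 hbk
  have hAG := prodBernoulli_strongHarris_sunflower_three p h₁ h₂ h₃ h12 h13 h23
  have ha1 : (prodBernoulli p).real A ≤ 1 := measureReal_le_one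
  have ha0 : 0 ≤ (prodBernoulli p).real A := measureReal_nonneg
  nlinarith [ha1, ha0, hAG, hLA]

/-! ### Dual rows (bottom shadows of the down-sets `D_i = (E_j ∪ E_k)ᶜ`, Lemma B) -/

/-- **Lemma B in cells** on the dual BK stratum: with `D₁ = (E₂ ∪ E₃)ᶜ`, `D₂ = (E₁ ∪ E₃)ᶜ`, `D₃ = (E₁ ∪ E₂)ᶜ`, `B = (E₁ ∪ E₂ ∪ E₃)ᶜ`
and `D₃ ⊆ bottomShadow D₁ B □ bottomShadow D₂ B`: `c₁c₂c₃ ≤ b·(ab − e₂)`, every `p`. [this work] -/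
theorem e3_le_bottom_mul_AG_of_bkB (p : ι → unitInterval) {E₁ E₂ E₃ A : Set (Set ι)} (h₁ : IsUpperSet E₁)
    (h₂ : IsUpperSet E₂) (h₃ : IsUpperSet E₃) (h12 : E₁ ∩ E₂ = A) (h13 : E₁ ∩ E₃ = A) (h23 : E₂ ∩ E₃ = A)
    (hbk : (E₁ ∪ E₂)ᶜ ⊆ bottomShadow (E₂ ∪ E₃)ᶜ (E₁ ∪ E₂ ∪ E₃)ᶜ □ bottomShadow (E₁ ∪ E₃)ᶜ (E₁ ∪ E₂ ∪ E₃)ᶜ) :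
    (prodBernoulli p).real (E₁ \ A) * (prodBernoulli p).real (E₂ \ A) * (prodBernoulli p).real (E₃ \ A) ≤
      (prodBernoulli p).real (E₁ ∪ E₂ ∪ E₃)ᶜ * ((prodBernoulli p).real A * (prodBernoulli p).real (E₁ ∪ E₂ ∪ E₃)ᶜ -
        ((prodBernoulli p).real (E₁ \ A) * (prodBernoulli p).real (E₂ \ A) +
          (prodBernoulli p).real (E₁ \ A) * (prodBernoulli p).real (E₃ \ A) +
          (prodBernoulli p).real (E₂ \ A) * (prodBernoulli p).real (E₃ \ A))) := by
  have key := lemmaB_of_bk p (h₂.union h₃).compl (h₁.union h₃).compl hbk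
  obtain ⟨d₁, d₂, d₃⟩ := PrincipalCore.cells_eq' p h12 h13 h23
  obtain ⟨-, -, -, eB⟩ := PrincipalCore.cells_eq p h12 h13 h23
  rw [d₁, d₂, d₃] at key
  have ha : (prodBernoulli p).real A = 1 - (prodBernoulli p).real (E₁ ∪ E₂ ∪ E₃)ᶜ - (prodBernoulli p).real (E₁ \ A)
      - (prodBernoulli p).real (E₂ \ A) - (prodBernoulli p).real (E₃ \ A) := by linarith
  rw [ha]
  nlinarith [key]

/-- **(C1-law) on the dual BK stratum**: `e₃ ≤ max(a,b)·(ab − e₂)`, every `p`. [this work] -/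
theorem e3_le_max_mul_AG_of_bkB (p : ι → unitInterval) {E₁ E₂ E₃ A : Set (Set ι)} (h₁ : IsUpperSet E₁)
    (h₂ : IsUpperSet E₂) (h₃ : IsUpperSet E₃) (h12 : E₁ ∩ E₂ = A) (h13 : E₁ ∩ E₃ = A) (h23 : E₂ ∩ E₃ = A)
    (hbk : (E₁ ∪ E₂)ᶜ ⊆ bottomShadow (E₂ ∪ E₃)ᶜ (E₁ ∪ E₂ ∪ E₃)ᶜ □ bottomShadow (E₁ ∪ E₃)ᶜ (E₁ ∪ E₂ ∪ E₃)ᶜ) :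
    (prodBernoulli p).real (E₁ \ A) * (prodBernoulli p).real (E₂ \ A) * (prodBernoulli p).real (E₃ \ A) ≤
      max ((prodBernoulli p).real A) ((prodBernoulli p).real (E₁ ∪ E₂ ∪ E₃)ᶜ) *
        ((prodBernoulli p).real A * (prodBernoulli p).real (E₁ ∪ E₂ ∪ E₃)ᶜ -
          ((prodBernoulli p).real (E₁ \ A) * (prodBernoulli p).real (E₂ \ A) +
            (prodBernoulli p).real (E₁ \ A) * (prodBernoulli p).real (E₃ \ A) +
            (prodBernoulli p).real (E₂ \ A) * (prodBernoulli p).real (E₃ \ A))) := by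
  have hLB := e3_le_bottom_mul_AG_of_bkB p h₁ h₂ h₃ h12 h13 h23 hbk
  have hAG := prodBernoulli_strongHarris_sunflower_three p h₁ h₂ h₃ h12 h13 h23
  have hmax : (prodBernoulli p).real (E₁ ∪ E₂ ∪ E₃)ᶜ ≤
      max ((prodBernoulli p).real A) ((prodBernoulli p).real (E₁ ∪ E₂ ∪ E₃)ᶜ) := le_max_right _ _
  nlinarith [hmax, hAG, hLB]

/-- **H-COMB on the dual BK stratum**: `(a + b)(ab − e₂) ≥ e₃`, every `p` (`H = LB + a·AG`). [this work] -/
theorem lawH_nonneg_of_bkB (p : ι → unitInterval) {E₁ E₂ E₃ A : Set (Set ι)} (h₁ : IsUpperSet E₁)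
    (h₂ : IsUpperSet E₂) (h₃ : IsUpperSet E₃) (h12 : E₁ ∩ E₂ = A) (h13 : E₁ ∩ E₃ = A) (h23 : E₂ ∩ E₃ = A)
    (hbk : (E₁ ∪ E₂)ᶜ ⊆ bottomShadow (E₂ ∪ E₃)ᶜ (E₁ ∪ E₂ ∪ E₃)ᶜ □ bottomShadow (E₁ ∪ E₃)ᶜ (E₁ ∪ E₂ ∪ E₃)ᶜ) :
    0 ≤ ((prodBernoulli p).real A + (prodBernoulli p).real (E₁ ∪ E₂ ∪ E₃)ᶜ) *
        ((prodBernoulli p).real A * (prodBernoulli p).real (E₁ ∪ E₂ ∪ E₃)ᶜ -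
          ((prodBernoulli p).real (E₁ \ A) * (prodBernoulli p).real (E₂ \ A) +
            (prodBernoulli p).real (E₁ \ A) * (prodBernoulli p).real (E₃ \ A) +
            (prodBernoulli p).real (E₂ \ A) * (prodBernoulli p).real (E₃ \ A))) -
      (prodBernoulli p).real (E₁ \ A) * (prodBernoulli p).real (E₂ \ A) * (prodBernoulli p).real (E₃ \ A) := by
  have hLB := e3_le_bottom_mul_AG_of_bkB p h₁ h₂ h₃ h12 h13 h23 hbk
  have hAG := prodBernoulli_strongHarris_sunflower_three p h₁ h₂ h₃ h12 h13 h23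
  have ha : 0 ≤ (prodBernoulli p).real A := measureReal_nonneg
  nlinarith [ha, hAG, hLB]

end Cells

/-! ## The coproduct class lies in the BK stratum -/

/-- **Coproduct structures are BK structures.**  For up-sets `Y₁, Y₂` determined by DISJOINT coordinate sets and any event `Y₃`:
`Y₁ ∩ Y₂ ⊆ coreShadow (Y₂ ∩ Y₃) (Y₁ ∩ Y₂ ∩ Y₃) □ coreShadow (Y₁ ∩ Y₃) (Y₁ ∩ Y₂ ∩ Y₃)` — the witnesses are the two supports.
[this work] -/
theorem coproduct_subset_disjointOccurrence {Y₁ Y₂ Y₃ : Set (Set ι)} (hY₁ : IsUpperSet Y₁) (hY₂ : IsUpperSet Y₂)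
    {S₁ S₂ : Set ι} (hd₁ : DeterminedBy Y₁ S₁) (hd₂ : DeterminedBy Y₂ S₂) (hS : Disjoint S₁ S₂) :
    Y₁ ∩ Y₂ ⊆ coreShadow (Y₂ ∩ Y₃) (Y₁ ∩ Y₂ ∩ Y₃) □ coreShadow (Y₁ ∩ Y₃) (Y₁ ∩ Y₂ ∩ Y₃) := by
  intro ω ⟨hω₁, hω₂⟩
  refine ⟨S₁, S₂, hS, ?_, ?_⟩
  · intro ω' hω'
    have hω'₁ : ω' ∈ Y₁ := by
      refine ((determinedBy_iff Y₁ S₁).1 hd₁ ω' ω ?_).2 hω₁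
      ext i
      simp only [Set.mem_inter_iff]
      exact ⟨fun ⟨h, hi⟩ => ⟨(hω' i hi).1 h, hi⟩, fun ⟨h, hi⟩ => ⟨(hω' i hi).2 h, hi⟩⟩
    intro T hT hT23
    exact ⟨⟨hY₁ hT hω'₁, hT23.1⟩, hT23.2⟩
  · intro ω' hω'
    have hω'₂ : ω' ∈ Y₂ := by
      refine ((determinedBy_iff Y₂ S₂).1 hd₂ ω' ω ?_).2 hω₂
      ext i
      simp only [Set.mem_inter_iff]
      exact ⟨fun ⟨h, hi⟩ => ⟨(hω' i hi).1 h, hi⟩, fun ⟨h, hi⟩ => ⟨(hω' i hi).2 h, hi⟩⟩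
    intro T hT hT13
    exact ⟨⟨hT13.1, hY₂ hT hω'₂⟩, hT13.2⟩

/-- **Lemma A on the coproduct class**, every `p`: for up-sets `Y₁, Y₂, Y₃` with `Y₁`, `Y₂` determined by disjoint coordinate
sets (`Y₃` unrestricted), the sunflower `E₁ = Y₂ ∩ Y₃`, `E₂ = Y₁ ∩ Y₃`, `E₃ = Y₁ ∩ Y₂` (core `Y₁ ∩ Y₂ ∩ Y₃`) satisfies
`μ(E₁) μ(E₂) μ(E₃) ≤ μ(Y₁ ∩ Y₂ ∩ Y₃)²`. [this work] -/
theorem lemmaA_of_coproduct [Fintype ι] (p : ι → unitInterval) {Y₁ Y₂ Y₃ : Set (Set ι)} (hY₁ : IsUpperSet Y₁)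
    (hY₂ : IsUpperSet Y₂) (hY₃ : IsUpperSet Y₃) {S₁ S₂ : Set ι} (hd₁ : DeterminedBy Y₁ S₁) (hd₂ : DeterminedBy Y₂ S₂)
    (hS : Disjoint S₁ S₂) :
    (prodBernoulli p).real (Y₂ ∩ Y₃) * (prodBernoulli p).real (Y₁ ∩ Y₃) * (prodBernoulli p).real (Y₁ ∩ Y₂) ≤
      ((prodBernoulli p).real (Y₁ ∩ Y₂ ∩ Y₃)) ^ 2 :=
  lemmaA_of_bk p (hY₂.inter hY₃) (hY₁.inter hY₃) (coproduct_subset_disjointOccurrence hY₁ hY₂ hd₁ hd₂ hS)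

/-- **Product structures are dual BK structures.**  For down-sets `Z₁, Z₂` determined by disjoint coordinate sets and any `Z₃`:
`Z₁ ∩ Z₂ ⊆ bottomShadow (Z₂ ∩ Z₃) (Z₁ ∩ Z₂ ∩ Z₃) □ bottomShadow (Z₁ ∩ Z₃) (Z₁ ∩ Z₂ ∩ Z₃)`. [this work] -/
theorem product_subset_disjointOccurrence {Z₁ Z₂ Z₃ : Set (Set ι)} (hZ₁ : IsLowerSet Z₁) (hZ₂ : IsLowerSet Z₂)
    {S₁ S₂ : Set ι} (hd₁ : DeterminedBy Z₁ S₁) (hd₂ : DeterminedBy Z₂ S₂) (hS : Disjoint S₁ S₂) :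
    Z₁ ∩ Z₂ ⊆ bottomShadow (Z₂ ∩ Z₃) (Z₁ ∩ Z₂ ∩ Z₃) □ bottomShadow (Z₁ ∩ Z₃) (Z₁ ∩ Z₂ ∩ Z₃) := by
  intro ω ⟨hω₁, hω₂⟩
  refine ⟨S₁, S₂, hS, ?_, ?_⟩
  · intro ω' hω'
    have hω'₁ : ω' ∈ Z₁ := by
      refine ((determinedBy_iff Z₁ S₁).1 hd₁ ω' ω ?_).2 hω₁
      ext i
      simp only [Set.mem_inter_iff]
      exact ⟨fun ⟨h, hi⟩ => ⟨(hω' i hi).1 h, hi⟩, fun ⟨h, hi⟩ => ⟨(hω' i hi).2 h, hi⟩⟩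
    intro T hT hT23
    exact ⟨⟨hZ₁ hT hω'₁, hT23.1⟩, hT23.2⟩
  · intro ω' hω'
    have hω'₂ : ω' ∈ Z₂ := by
      refine ((determinedBy_iff Z₂ S₂).1 hd₂ ω' ω ?_).2 hω₂
      ext i
      simp only [Set.mem_inter_iff]
      exact ⟨fun ⟨h, hi⟩ => ⟨(hω' i hi).1 h, hi⟩, fun ⟨h, hi⟩ => ⟨(hω' i hi).2 h, hi⟩⟩
    intro T hT hT13
    exact ⟨⟨hT13.1, hZ₂ hT hω'₂⟩, hT13.2⟩

/-- **Lemma B on the product class**, every `p`: for down-sets `Z₁, Z₂, Z₃` with `Z₁`, `Z₂` determined by disjoint coordinate sets,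
`μ(Z₂ ∩ Z₃) μ(Z₁ ∩ Z₃) μ(Z₁ ∩ Z₂) ≤ μ(Z₁ ∩ Z₂ ∩ Z₃)²` (the down-sets `D_i = Z_j ∩ Z_k` of the product class `PC(W)`, `Z_i = W_iᶜ`).
[this work] -/
theorem lemmaB_of_product [Fintype ι] (p : ι → unitInterval) {Z₁ Z₂ Z₃ : Set (Set ι)} (hZ₁ : IsLowerSet Z₁)
    (hZ₂ : IsLowerSet Z₂) (hZ₃ : IsLowerSet Z₃) {S₁ S₂ : Set ι} (hd₁ : DeterminedBy Z₁ S₁) (hd₂ : DeterminedBy Z₂ S₂)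
    (hS : Disjoint S₁ S₂) :
    (prodBernoulli p).real (Z₂ ∩ Z₃) * (prodBernoulli p).real (Z₁ ∩ Z₃) * (prodBernoulli p).real (Z₁ ∩ Z₂) ≤
      ((prodBernoulli p).real (Z₁ ∩ Z₂ ∩ Z₃)) ^ 2 :=
  lemmaB_of_bk p (hZ₂.inter hZ₃) (hZ₁.inter hZ₃) (product_subset_disjointOccurrence hZ₁ hZ₂ hd₁ hd₂ hS)

end BKStratum

end Summit.CriticalPhenomena.PercolationContinuityZ3.Theorems.SunflowerPartition

end
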